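import Mathlib
import Summits.QuantumFields.BalabanUV.Beta.CoarseCoerciveBumpCalculus

/-!
# [Balaban1984PropagatorsII] (2.76) p. 236 «Q′_jG′_jQ′_j* ≥ 2γ₀; γ₀ is a positive, absolute constant» — THE U = 1, ν = 1
# MODEL NODE OF E-I3 BY COUNTING: on `m` blocks of `n` sites (unit lattice, any gluing of the block ends — torus or line),
# fine form `A = μ + D*D` (`D` = all bond differences), block-MEAN constraint `Q̃`, in-block PLATEAU bumps with ramps of
# width `w` (`4w ≤ n`): `Re B*(Q̃A⁻¹Q̃ᵀ)B ≥ ((1 − 2w∕n)²∕(μn + n∕w²))·‖B‖²` — so at `n = 4w`, `μ = a∕n²` the constant is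
# `n∕(4(a + 16))`, the CORRECT scaling in the block size `n` (the block-constant extension gives only `O(1)`), uniform in the
# volume `m`; no Fourier analysis (cell topic `Summits/QuantumFields/BalabanUV/Beta`; row-D4 interface item (I3), E-I3)

HONEST FRAMING (cell rule).  Discharging `BetaPertH` makes Bałaban's UV stability UNCONDITIONAL — a real constructive-QFT
result; NOT the continuum limit, NOT the Clay problem.  This module discharges NOTHING of `BetaPertH`.  [folklore]: the
SIMPLEST lattice instance of NOTE-I3's E-I3 («a bounded-energy quasi-reconstruction for the averaging Q̃ relative to the
fine form, uniform in the block size»), MODEL currency (U = 1, ν = 1, scalar field, free massive Laplacian), from the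
owner's gen-39 engines `CoarseCoerciveQuasiReconstruction` (c²∕E) and `CoarseCoerciveBumpCalculus` (E = μS₁S₂ + θ₁θ₂) by
COUNTING: in-block plateau bumps vanishing at the block ends (bumps of different blocks never interact: `S₁ = 1`, mass
matrix DIAGONAL `≥ 1 − 2w∕n`, gluing-bond pairings `0`), slope `≤ 1∕w` (`θ₁ ≤ 1∕w`, `θ₂ ≤ n∕w`), mass `S₂ ≤ n`.  WHAT IT
SHOWS: the coarse operator's lower bound scales like `n` (lattice units, `μ = a∕n²`) — B6 (2.76)'s «absolute constant»
after Bałaban's rescaling — from SMOOTH bumps; the block-CONSTANT extension (a unit jump on each gluing bond) has energy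
`O(1)` instead of `O(1∕n)`, a constant WORSE by the factor `n` (NOTE-I3 §3 (b2)).  ν ≥ 2 = product plateaus, same calculus
(`S₁ = 1`, diagonal mass `(1 − 2w∕n)^ν`, `θ₁ ≤ 1∕w`, `θ₂ ≤ νn^ν∕w`, `E ~ n^{ν−2}`) — NOT built here.  Nothing of Bałaban's
operators is instantiated (no background field, no vector fields, no multiscale norms); NO class change on any GAPS row
(G-B9-15 decomposed, not closed); readiness width 0 unchanged; NOT summit progress.  Unit `b2b-balaban-beta-an4-g39`
(owner lineage of `BINDER-OWNERS.md` row D4); `GAPS.md` C-an4-107.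

CITATION HEADER (lean-in-tree rule).  [B6] = T. Bałaban, *Propagators and renormalization transformations for lattice
gauge theories. II*, Commun. Math. Phys. **96**, 223–250 (1984) [Balaban1984PropagatorsII], p. 236 [PDF 14] (render
`HOME/b2b-balaban-ref1/pages/1984-cmp96-propagators-rt-II/…-p014-x2.png`, READ AS IMAGE 2026-08-20), verbatim: *"From
this representation and the bounds (2.50), (2.51) of that paper it follows that Q′_jG′_jQ′_j* ≥ 2γ₀; (2.76) γ₀ is a
positive, absolute constant (a = 1)."*  LOCATOR only; nothing printed is asserted — the statement below is about OUR
model operator, proved by a different route.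

WHAT IS CERTIFIED HERE (kernel, sorry-free; [folklore]).
§1 GRAM FORMS: `gramForm μ D := μ·1 + Dᴴ·D`, `form_gramForm` (`z*Az = μ‖z‖² + ‖Dz‖²`), `gramForm_isHermitian`,
   `re_form_gramForm_nonneg`, `isUnit_gramForm` (`μ > 0`).
§2 THE 1-D DATA: `plateau n w` (`min(1, i∕w, (n−1−i)∕w)`; `0` at both block ends, `1∕w`-Lipschitz, `Σ ≥ n − 2w`), sites
   `Fin m × Fin n`, `bump`, block means `bmean`, bond differences `bondD σ` (intra-block bonds + one gluing bond per block
   to `σ y`), pairings (`bondPairing_inl`, `bondPairing_inr = 0`), mass matrix (`massMatrix_bump_bmean`, diagonal).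
§3 **`coarse_coercive_block1D`** — `0 < m`, `0 < w`, `4w ≤ n`, `0 < μ`, any gluing `σ` ⟹
   `((1 − 2w∕n)²∕(μ·n + n∕w²))·‖B‖² ≤ Re B*(sandwich (gramForm μ (bondD σ)) bmean)B` for every `B : Fin m → ℂ`;
   `coarse_coercive_block1D_scaling` — at `n = 4w`, `μ = a∕n²`: constant `n∕(4(a + 16))`.
NOT CLAIMED.  ν ≥ 2 (product plateaus — same calculus); background fields; Bałaban's norms; (3.132).  NOT summit progress.
PRIOR ART IN THE TREE (searched 2026-08-20: `lean search 'plateau|trapezoid|gramForm|bmean'`): the gen-39 engines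
(USED); gan24∕an2 `KKTFluctuationKernel.decay_Gam` (fixed-N, a different object); d4-p3 `UnitLatticePartition` (partition
of unity, not a reconstruction).  No coarse-operator lower bound uniform in the block size in the tree.
-/

namespace Summit.QuantumFields.BalabanUV.Beta.CoarseCoerciveBlock1D

open scoped BigOperators Matrix ComplexConjugate
open Finset Matrix
open Summit.QuantumFields.BalabanUV.Beta.AccretiveCombesThomasSandwich (sandwich)
open Summit.QuantumFields.BalabanUV.Beta.UnitLatticeResolventWalk (Qm superpose)
open Summit.QuantumFields.BalabanUV.Beta.CoarseCoerciveQuasiReconstruction (massMatrix)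
open Summit.QuantumFields.BalabanUV.Beta.CoarseCoerciveBumpCalculus (bondPairing bondPairing_apply coarse_coercive_of_bumps)
open Literature.MathematicalPhysics.QuantumFieldTheory.Balaban1983to89.B5Prop11Lower (nsq nsq_nonneg
  star_dotProduct_self)

noncomputable section

/-! ## §1 Gram forms `μ + D*D` -/

section Gram

variable {ι X : Type*} [Fintype ι] [Fintype X] [DecidableEq X]

/-- The GRAM FORM `μ·1 + Dᴴ·D` (massive Laplacian when `D` = the bond differences). [folklore] -/
def gramForm (μ : ℝ) (D : Matrix ι X ℂ) : Matrix X X ℂ := ((μ : ℝ) : ℂ) • (1 : Matrix X X ℂ) + Dᴴ * D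

/-- `z*(μ + D*D)z = μ‖z‖² + ‖Dz‖²`. [folklore] -/
theorem form_gramForm (μ : ℝ) (D : Matrix ι X ℂ) (z : X → ℂ) :
    star z ⬝ᵥ (gramForm μ D *ᵥ z) = ((μ * nsq z + nsq (D *ᵥ z) : ℝ) : ℂ) := by
  rw [gramForm, Matrix.add_mulVec, Matrix.smul_mulVec, Matrix.one_mulVec, dotProduct_add, dotProduct_smul,
    ← Matrix.mulVec_mulVec, Matrix.dotProduct_mulVec, Matrix.vecMul_conjTranspose, star_star, star_dotProduct_self,
    star_dotProduct_self, smul_eq_mul, Complex.ofReal_add, Complex.ofReal_mul]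

/-- Hence `Re z*(μ + D*D)z = μ‖z‖² + ‖Dz‖²` — the Gram domination holds with EQUALITY. [folklore] -/
theorem re_form_gramForm (μ : ℝ) (D : Matrix ι X ℂ) (z : X → ℂ) :
    (star z ⬝ᵥ (gramForm μ D *ᵥ z)).re = μ * nsq z + nsq (D *ᵥ z) := by
  rw [form_gramForm, Complex.ofReal_re]

omit [Fintype X] in
/-- `μ + D*D` is Hermitian. [folklore] -/
theorem gramForm_isHermitian (μ : ℝ) (D : Matrix ι X ℂ) : (gramForm μ D).IsHermitian := by
  rw [gramForm, Matrix.IsHermitian, Matrix.conjTranspose_add, Matrix.conjTranspose_smul, Matrix.conjTranspose_one,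
    Matrix.conjTranspose_mul, Matrix.conjTranspose_conjTranspose, Complex.star_def, Complex.conj_ofReal]

/-- `Re z*(μ + D*D)z ≥ 0` for `μ ≥ 0`. [folklore] -/
theorem re_form_gramForm_nonneg {μ : ℝ} (hμ : 0 ≤ μ) (D : Matrix ι X ℂ) (z : X → ℂ) :
    0 ≤ (star z ⬝ᵥ (gramForm μ D *ᵥ z)).re := by
  rw [re_form_gramForm]
  exact add_nonneg (mul_nonneg hμ (nsq_nonneg z)) (nsq_nonneg _)

/-- `μ + D*D` is invertible for `μ > 0` (its kernel is trivial: `Az = 0 ⟹ μ‖z‖² ≤ 0`). [folklore] -/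
theorem isUnit_gramForm {μ : ℝ} (hμ : 0 < μ) (D : Matrix ι X ℂ) : IsUnit (gramForm μ D) := by
  refine Matrix.mulVec_injective_iff_isUnit.1 fun z₁ z₂ h => ?_
  have hz : gramForm μ D *ᵥ (z₁ - z₂) = 0 := by rw [Matrix.mulVec_sub, h, sub_self]
  have hre := re_form_gramForm μ D (z₁ - z₂)
  rw [hz, dotProduct_zero, Complex.zero_re] at hre
  have hn : nsq (z₁ - z₂) = 0 := by
    have h1 := nsq_nonneg (z₁ - z₂)
    have h2 := nsq_nonneg (D *ᵥ (z₁ - z₂))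
    nlinarith
  have hzero : ∀ x, (z₁ - z₂) x = 0 := fun x => by
    have := (Finset.sum_eq_zero_iff_of_nonneg fun y _ => by positivity).1 hn x (Finset.mem_univ x)
    exact norm_eq_zero.1 (pow_eq_zero_iff two_ne_zero |>.1 this)
  funext x
  exact sub_eq_zero.1 (hzero x)

end Gram

/-! ## §2 The 1-D data: plateau bumps on blocks of `n` sites -/

section OneD

variable {m n w : ℕ}

/-- THE PLATEAU PROFILE on a block of `n` sites with ramps of width `w`: `t(i) = min(1, i∕w, (n − 1 − i)∕w)`. [folklore] -/
def plateau (n w : ℕ) (i : Fin n) : ℝ := min 1 (min ((i : ℝ) / w) (((n : ℝ) - 1 - i) / w))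

/-- `0 ≤ t`. [folklore] -/
theorem plateau_nonneg (hw : 0 < w) (i : Fin n) : 0 ≤ plateau n w i := by
  have hi : (i : ℝ) + 1 ≤ n := by exact_mod_cast i.2
  exact le_min zero_le_one (le_min (by positivity) (div_nonneg (by linarith) (Nat.cast_nonneg w)))

/-- `|t| ≤ 1` (as a complex number). [folklore] -/
theorem norm_plateau_le (hw : 0 < w) (i : Fin n) : ‖((plateau n w i : ℝ) : ℂ)‖ ≤ 1 := by
  rw [Complex.norm_real, Real.norm_of_nonneg (plateau_nonneg hw i)]
  exact min_le_left _ _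

/-- `t = 0` at the left end of the block. [folklore] -/
theorem plateau_left (hw : 0 < w) (i : Fin n) (hi : (i : ℕ) = 0) : plateau n w i = 0 := by
  have h0 : ((i : ℕ) : ℝ) = 0 := by exact_mod_cast hi
  refine le_antisymm ?_ (plateau_nonneg hw i)
  exact (min_le_right _ _).trans ((min_le_left _ _).trans (by rw [h0, zero_div]))

/-- `t = 0` at the right end of the block. [folklore] -/
theorem plateau_right (hw : 0 < w) (i : Fin n) (hi : (i : ℕ) + 1 = n) : plateau n w i = 0 := by
  have h1 : ((i : ℕ) : ℝ) + 1 = n := by exact_mod_cast hi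
  have h0 : (n : ℝ) - 1 - i = 0 := by linarith
  refine le_antisymm ?_ (plateau_nonneg hw i)
  exact (min_le_right _ _).trans ((min_le_right _ _).trans (by rw [h0, zero_div]))

/-- `t` is `1∕w`-Lipschitz along bonds. [folklore] -/
theorem abs_plateau_sub_le (hw : 0 < w) (i j : Fin n) (hij : (j : ℕ) = i + 1) :
    |plateau n w j - plateau n w i| ≤ 1 / w := by
  have hw' : (0 : ℝ) < w := by exact_mod_cast hw
  have hj : ((j : ℕ) : ℝ) = i + 1 := by exact_mod_cast hij
  unfold plateau
  refine (abs_min_sub_min_le_max _ _ _ _).trans (max_le (by simp) ?_)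
  refine (abs_min_sub_min_le_max _ _ _ _).trans (max_le ?_ ?_)
  · rw [hj, ← sub_div, add_sub_cancel_left, abs_of_pos (div_pos one_pos hw')]
  · rw [hj, ← sub_div, show ((n : ℝ) - 1 - (i + 1) - ((n : ℝ) - 1 - i)) = -1 by ring, abs_div, abs_neg, abs_one,
      abs_of_pos hw']

/-- `t ≥ 1 − [i < w] − [i + w ≥ n]` pointwise (it is `1` on the core and `≥ 0` on the ramps). [folklore] -/
theorem plateau_ge_indicator (hw : 0 < w) (i : Fin n) :
    1 - (if (i : ℕ) < w then (1 : ℝ) else 0) - (if n ≤ (i : ℕ) + w then (1 : ℝ) else 0) ≤ plateau n w i := by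
  have hw' : (0 : ℝ) < w := by exact_mod_cast hw
  by_cases h1 : (i : ℕ) < w
  · rw [if_pos h1]
    have := plateau_nonneg hw i
    split_ifs <;> linarith
  · rw [if_neg h1]
    by_cases h2 : n ≤ (i : ℕ) + w
    · rw [if_pos h2]; linarith [plateau_nonneg hw i]
    · rw [if_neg h2, sub_zero, sub_zero]
      rw [not_lt] at h1
      rw [not_le] at h2
      have hi1 : (w : ℝ) ≤ i := by exact_mod_cast h1
      have hi2 : ((i : ℕ) : ℝ) + w + 1 ≤ n := by exact_mod_cast h2
      unfold plateau
      refine le_min le_rfl (le_min ?_ ?_)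
      · rwa [le_div_iff₀ hw', one_mul]
      · rw [le_div_iff₀ hw', one_mul]; linarith

/-- **`Σ_i t(i) ≥ n − 2w`** (each ramp removes at most `w` from the count). [folklore] -/
theorem sum_plateau_ge (hw : 0 < w) : (n : ℝ) - 2 * w ≤ ∑ i : Fin n, plateau n w i := by
  have hL : ((Finset.univ.filter fun i : Fin n => (i : ℕ) < w).card : ℝ) ≤ w := by
    have h := Finset.card_le_card_of_injOn (s := Finset.univ.filter fun i : Fin n => (i : ℕ) < w)
      (t := Finset.range w) (fun i => (i : ℕ)) (fun i hi => by simpa using hi) (fun a _ b _ hab => Fin.ext hab)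
    simpa using (show ((Finset.univ.filter fun i : Fin n => (i : ℕ) < w).card : ℝ) ≤ (Finset.range w).card by
      exact_mod_cast h)
  have hR : ((Finset.univ.filter fun i : Fin n => n ≤ (i : ℕ) + w).card : ℝ) ≤ w := by
    have h := Finset.card_le_card_of_injOn (s := Finset.univ.filter fun i : Fin n => n ≤ (i : ℕ) + w)
      (t := Finset.range w) (fun i => n - 1 - (i : ℕ))
      (fun i hi => by
        simp only [Finset.coe_filter, Finset.mem_univ, true_and, Set.mem_setOf_eq] at hi
        simp only [Finset.coe_range, Set.mem_Iio]
        have := i.2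
        omega)
      (fun a ha b hb hab => by
        have := a.2; have := b.2
        exact Fin.ext (by simp only at hab; omega))
    simpa using (show ((Finset.univ.filter fun i : Fin n => n ≤ (i : ℕ) + w).card : ℝ) ≤ (Finset.range w).card by
      exact_mod_cast h)
  calc (n : ℝ) - 2 * w ≤ (n : ℝ) - ((Finset.univ.filter fun i : Fin n => (i : ℕ) < w).card : ℝ)
        - ((Finset.univ.filter fun i : Fin n => n ≤ (i : ℕ) + w).card : ℝ) := by linarith
    _ = ∑ i : Fin n, (1 - (if (i : ℕ) < w then (1 : ℝ) else 0) - (if n ≤ (i : ℕ) + w then (1 : ℝ) else 0)) := by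
        rw [Finset.sum_sub_distrib, Finset.sum_sub_distrib, Finset.sum_const, Finset.card_univ, Fintype.card_fin,
          nsmul_eq_mul, mul_one, Finset.sum_boole, Finset.sum_boole]
    _ ≤ ∑ i : Fin n, plateau n w i := Finset.sum_le_sum fun i _ => plateau_ge_indicator hw i

/-- THE BUMPS: the plateau of block `y`, zero elsewhere. [folklore] -/
def bump (n w : ℕ) (y : Fin m) (x : Fin m × Fin n) : ℂ := if x.1 = y then ((plateau n w x.2 : ℝ) : ℂ) else 0

/-- THE BLOCK-MEAN CONSTRAINT: `q_y = n⁻¹·1_{block y}`. [folklore] -/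
def bmean (n : ℕ) (y : Fin m) (x : Fin m × Fin n) : ℂ := if x.1 = y then (((n : ℝ)⁻¹ : ℝ) : ℂ) else 0

/-- THE BOND DIFFERENCES: intra-block bonds `(y, i) ~ (y, i+1)` (rows `inl (y, i)` with `i + 1 < n`; the row is `0` for the
last `i`) and one GLUING bond per block from its right end `(y, n−1)` to the left end `(σ y, 0)` of block `σ y` (torus:
`σ` = rotation; any `σ` is allowed). [folklore] -/
def bondD (m n : ℕ) (σ : Fin m → Fin m) : Matrix ((Fin m × Fin n) ⊕ Fin m) (Fin m × Fin n) ℂ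
  | Sum.inl (y, i), x => if (i : ℕ) + 1 < n then
      ((if x.1 = y ∧ (x.2 : ℕ) = i + 1 then 1 else 0) - (if x.1 = y ∧ (x.2 : ℕ) = i then 1 else 0)) else 0
  | Sum.inr y, x => (if x.1 = σ y ∧ (x.2 : ℕ) = 0 then 1 else 0) - (if x.1 = y ∧ (x.2 : ℕ) + 1 = n then 1 else 0)

/-- A site indicator against a bump picks the plateau value: `Σ_x [x.1 = y₀ ∧ x.2 = k]·bump y x = [y₀ = y]·t(k)` (and `0`
if `k ≥ n`). [folklore] -/
theorem sum_indicator_bump (y₀ y : Fin m) (P : ℕ → Prop) [DecidablePred P] :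
    ∑ x : Fin m × Fin n, (if x.1 = y₀ ∧ P (x.2 : ℕ) then (1 : ℂ) else 0) * bump n w y x =
      if y₀ = y then ∑ i : Fin n, (if P (i : ℕ) then ((plateau n w i : ℝ) : ℂ) else 0) else 0 := by
  rw [Fintype.sum_prod_type]
  simp only [bump]
  by_cases hy : y₀ = y
  · subst hy
    rw [if_pos rfl, Finset.sum_eq_single y₀ (fun b _ hb => by simp [hb]) (fun h => (h (mem_univ _)).elim)]
    simp only [true_and, if_true]
    refine Finset.sum_congr rfl fun i _ => ?_
    split_ifs <;> simp
  · rw [if_neg hy]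
    refine Finset.sum_eq_zero fun b _ => Finset.sum_eq_zero fun i _ => ?_
    by_cases hb : b = y₀
    · subst hb; simp [hy]
    · simp [hb]

/-- A point predicate holds for at most one `i : Fin n`: the filtered sum has at most one term. [folklore] -/
theorem sum_ite_point (k : ℕ) (f : Fin n → ℂ) :
    ∑ i : Fin n, (if (i : ℕ) = k then f i else 0) = if h : k < n then f ⟨k, h⟩ else 0 := by
  by_cases h : k < n
  · rw [dif_pos h, Finset.sum_eq_single ⟨k, h⟩ (fun b _ hb => if_neg fun hbk => hb (Fin.ext hbk))
      (fun h' => (h' (mem_univ _)).elim), if_pos rfl]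
  · rw [dif_neg h]
    exact Finset.sum_eq_zero fun i _ => if_neg fun hik => h (by rw [← hik]; exact i.2)

/-- **Intra-block pairings**: `(D·bump_{y′})_{(y,i)} = [y = y′]·(t(i+1) − t(i))` for `i + 1 < n`, else `0`. [folklore] -/
theorem bondPairing_inl (σ : Fin m → Fin m) (y y' : Fin m) (i : Fin n) :
    bondPairing (bondD m n σ) (bump n w) (Sum.inl (y, i)) y' =
      if h : (i : ℕ) + 1 < n then
        (if y = y' then ((plateau n w ⟨(i : ℕ) + 1, h⟩ : ℝ) : ℂ) - ((plateau n w i : ℝ) : ℂ) else 0) else 0 := by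
  rw [bondPairing_apply]
  by_cases h : (i : ℕ) + 1 < n
  · rw [dif_pos h]
    simp only [bondD, if_pos h, sub_mul, Finset.sum_sub_distrib]
    rw [sum_indicator_bump y y' (fun a => a = (i : ℕ) + 1), sum_indicator_bump y y' (fun a => a = (i : ℕ))]
    by_cases hy : y = y'
    · rw [if_pos hy, if_pos hy, if_pos hy, sum_ite_point, sum_ite_point, dif_pos h, dif_pos i.2]
    · rw [if_neg hy, if_neg hy, if_neg hy, sub_zero]
  · rw [dif_neg h]
    simp only [bondD, if_neg h, zero_mul, Finset.sum_const_zero]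

/-- **Gluing-bond pairings vanish** (the bumps are `0` at both block ends). [folklore] -/
theorem bondPairing_inr (hw : 0 < w) (σ : Fin m → Fin m) (y y' : Fin m) :
    bondPairing (bondD m n σ) (bump n w) (Sum.inr y) y' = 0 := by
  rw [bondPairing_apply]
  simp only [bondD, sub_mul, Finset.sum_sub_distrib]
  rw [sum_indicator_bump (σ y) y' (fun a => a = 0), sum_indicator_bump y y' (fun a => a + 1 = n)]
  have h1 : ∑ i : Fin n, (if (i : ℕ) = 0 then ((plateau n w i : ℝ) : ℂ) else 0) = 0 :=
    Finset.sum_eq_zero fun i _ => by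
      split_ifs with hi
      · rw [plateau_left hw i hi, Complex.ofReal_zero]
      · rfl
  have h2 : ∑ i : Fin n, (if (i : ℕ) + 1 = n then ((plateau n w i : ℝ) : ℂ) else 0) = 0 :=
    Finset.sum_eq_zero fun i _ => by
      split_ifs with hi
      · rw [plateau_right hw i hi, Complex.ofReal_zero]
      · rfl
  rw [h1, h2]
  simp

/-- **The mass matrix is DIAGONAL**: `(Qm bump·(Qm bmean)ᴴ)(y, y′) = [y = y′]·n⁻¹·Σ_i t(i)`. [folklore] -/
theorem massMatrix_bump_bmean (y y' : Fin m) :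
    massMatrix (bump (m := m) n w) (bmean n) y y' =
      if y = y' then ((((n : ℝ)⁻¹ * ∑ i : Fin n, plateau n w i : ℝ)) : ℂ) else 0 := by
  rw [massMatrix, Matrix.mul_apply]
  simp only [Qm, Matrix.conjTranspose_apply, bump, bmean, Complex.star_def]
  rw [Fintype.sum_prod_type]
  by_cases hy : y = y'
  · subst hy
    rw [if_pos rfl, Finset.sum_eq_single y (fun b _ hb => by simp [hb]) (fun h => (h (mem_univ _)).elim)]
    simp only [if_true, Complex.conj_ofReal]
    rw [Complex.ofReal_mul, Complex.ofReal_sum, Finset.mul_sum]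
    refine Finset.sum_congr rfl fun i _ => by ring
  · rw [if_neg hy]
    refine Finset.sum_eq_zero fun b _ => Finset.sum_eq_zero fun i _ => ?_
    by_cases hb : b = y
    · subst hb; simp [hy]
    · simp [hb]

/-! ## §3 The estimate -/

/-- **COARSE COERCIVITY ON 1-D BLOCKS, UNIFORM IN THE BLOCK SIZE AND THE VOLUME.**  `m ≥ 1` blocks of `n` sites, ramps
`0 < w`, `4w ≤ n`, mass `μ > 0`, any gluing `σ`:
`((1 − 2w∕n)²∕(μ·n + n∕w²))·‖B‖² ≤ Re B*(Q̃ (μ + D*D)⁻¹ Q̃*)B` for every coarse `B` — by `coarse_coercive_of_bumps` with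
`S₁ = 1`, `S₂ = n`, `θ₁ = 1∕w`, `θ₂ = n∕w`, `δ = 1 − 2w∕n`, `σ = 0`. [cite: Balaban1984PropagatorsII, (2.76) p.236] -/
theorem coarse_coercive_block1D (hn : 4 * w ≤ n) (hw : 0 < w) {μ : ℝ} (hμ : 0 < μ) (σ : Fin m → Fin m)
    (B : Fin m → ℂ) :
    (1 - 2 * w / n) ^ 2 / (μ * n + n / w ^ 2) * nsq B ≤
      (star B ⬝ᵥ (sandwich (gramForm μ (bondD m n σ)) (bmean n) *ᵥ B)).re := by
  have hw' : (0 : ℝ) < w := by exact_mod_cast hw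
  have hn0 : 0 < n := lt_of_lt_of_le (by omega) hn
  have hn' : (0 : ℝ) < n := by exact_mod_cast hn0
  have hwn : (4 : ℝ) * w ≤ n := by exact_mod_cast hn
  -- the constant, rewritten in `coarse_coercive_of_bumps`'s shape
  have hshape : (1 - 2 * w / n) ^ 2 / (μ * n + n / w ^ 2) =
      ((1 - 2 * w / n) - 0) ^ 2 / (μ * (1 * n) + 1 / w * (n / w)) := by
    rw [sub_zero, one_mul, div_mul_div_comm, one_mul, sq (w : ℝ)]
  rw [hshape]
  refine coarse_coercive_of_bumps (gramForm μ (bondD m n σ)) (gramForm_isHermitian _ _) (isUnit_gramForm hμ _)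
    (re_form_gramForm_nonneg hμ.le _) (bondD m n σ) hμ.le (fun z => (re_form_gramForm μ _ z).le) (bmean n) (bump n w)
    zero_le_one (fun x => ?_) (fun y => ?_) (by positivity) (fun b => ?_) (fun y => ?_) (by positivity) ?_
    (fun y => ?_) (fun y => ?_) (by
      have : 2 * (w : ℝ) / n ≤ 1 / 2 := by rw [div_le_iff₀ hn']; linarith
      linarith) B
  · -- overlap S₁ = 1: only the block of `x` contributes, value ≤ 1
    simp only [bump]
    rw [Finset.sum_eq_single x.1 (fun y _ hy => by rw [if_neg (Ne.symm hy), norm_zero])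
      (fun h => (h (mem_univ _)).elim), if_pos rfl]
    exact norm_plateau_le hw x.2
  · -- mass S₂ = n
    simp only [bump]
    rw [Fintype.sum_prod_type, Finset.sum_eq_single y (fun b _ hb => by simp [hb]) (fun h => (h (mem_univ _)).elim)]
    simp only [if_true]
    calc ∑ i : Fin n, ‖((plateau n w i : ℝ) : ℂ)‖ ≤ ∑ _i : Fin n, (1 : ℝ) := Finset.sum_le_sum fun i _ => norm_plateau_le hw i
      _ = n := by simp
  · -- θ₁ = 1/w: one bump per bond
    rcases b with ⟨y, i⟩ | y
    · simp only [bondPairing_inl]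
      by_cases h : (i : ℕ) + 1 < n
      · simp only [dif_pos h]
        rw [Finset.sum_eq_single y (fun y' _ hy' => by rw [if_neg (Ne.symm hy'), norm_zero])
          (fun h' => (h' (mem_univ _)).elim), if_pos rfl, ← Complex.ofReal_sub, Complex.norm_real, Real.norm_eq_abs]
        exact abs_plateau_sub_le hw i ⟨(i : ℕ) + 1, h⟩ rfl
      · simp only [dif_neg h, norm_zero, Finset.sum_const_zero]; positivity
    · simp only [bondPairing_inr hw, norm_zero, Finset.sum_const_zero]; positivity
  · -- θ₂ = n/w: the total variation of one bump, crudely `n` bonds × slope `1/w`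
    rw [Fintype.sum_sum_type]
    simp only [bondPairing_inr hw, norm_zero, Finset.sum_const_zero, add_zero]
    rw [Fintype.sum_prod_type, Finset.sum_eq_single y (fun b _ hb => by
      refine Finset.sum_eq_zero fun i _ => ?_
      simp only [bondPairing_inl]
      split_ifs <;> simp_all) (fun h => (h (mem_univ _)).elim)]
    calc ∑ i : Fin n, ‖bondPairing (bondD m n σ) (bump n w) (Sum.inl (y, i)) y‖ ≤ ∑ _i : Fin n, (1 : ℝ) / w := by
          refine Finset.sum_le_sum fun i _ => ?_
          simp only [bondPairing_inl, if_true]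
          split_ifs with h
          · rw [← Complex.ofReal_sub, Complex.norm_real, Real.norm_eq_abs]
            exact abs_plateau_sub_le hw i ⟨(i : ℕ) + 1, h⟩ rfl
          · rw [norm_zero]; positivity
      _ = n / w := by simp [div_eq_mul_inv]
  · -- the mass matrix is Hermitian (real diagonal)
    have hM : massMatrix (bump (m := m) n w) (bmean n) =
        Matrix.diagonal fun _ => ((((n : ℝ)⁻¹ * ∑ i : Fin n, plateau n w i : ℝ)) : ℂ) := by
      ext y y'
      rw [massMatrix_bump_bmean, Matrix.diagonal_apply]
    rw [hM, Matrix.isHermitian_diagonal_iff]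
    intro y
    rw [isSelfAdjoint_iff, Complex.star_def, Complex.conj_ofReal]
  · -- diagonal ≥ 1 − 2w/n
    rw [massMatrix_bump_bmean, if_pos rfl, Complex.ofReal_re]
    have hs := sum_plateau_ge (n := n) hw
    rw [show (1 : ℝ) - 2 * w / n = (n : ℝ)⁻¹ * (n - 2 * w) by field_simp]
    exact mul_le_mul_of_nonneg_left hs (inv_nonneg.2 hn'.le)
  · -- off-diagonal row sums vanish
    refine le_of_eq (Finset.sum_eq_zero fun y' hy' => ?_)
    rw [massMatrix_bump_bmean, if_neg (Finset.ne_of_mem_erase hy').symm, norm_zero]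

/-- **THE SCALING**: at `n = 4w` and `μ = a∕n²` (`a > 0`) the constant is `n∕(4(a + 16))` — LINEAR in the block size `n`
(the correct scaling of the coarse operator of a massive Laplacian averaged over blocks of `n` sites; the block-constant
extension would give only `O(1)`), uniform in the volume `m`. [folklore] -/
theorem coarse_coercive_block1D_scaling (hw : 0 < w) (hn : n = 4 * w) {a : ℝ} (ha : 0 < a) (σ : Fin m → Fin m)
    (B : Fin m → ℂ) :
    (n : ℝ) / (4 * (a + 16)) * nsq B ≤
      (star B ⬝ᵥ (sandwich (gramForm (a / (n : ℝ) ^ 2) (bondD m n σ)) (bmean n) *ᵥ B)).re := by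
  have hw' : (0 : ℝ) < w := by exact_mod_cast hw
  have hn' : (n : ℝ) = 4 * w := by exact_mod_cast hn
  have h := coarse_coercive_block1D (m := m) (le_of_eq hn.symm) hw (μ := a / (n : ℝ) ^ 2) (by rw [hn']; positivity) σ B
  have hconst : (1 - 2 * (w : ℝ) / n) ^ 2 / (a / (n : ℝ) ^ 2 * n + n / (w : ℝ) ^ 2) = (n : ℝ) / (4 * (a + 16)) := by
    rw [hn']
    field_simp
    ring
  rwa [hconst] at h

end OneD

end

end Summit.QuantumFields.BalabanUV.Beta.CoarseCoerciveBlock1D
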